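import Summits.QuantumFields.YangMills.Theorems.BalabanUVNodesK0AxCtabUniq
import Summits.QuantumFields.YangMills.Theorems.BalabanUVNodesK0RecordFormatNamesOrbit

/-!
# (R-a) bridge (B-5, v2): the displayed orbit letter (C-orb) ⟺ «weakly critical modulo an UNRESTRICTED gauge» — (C-orb) in [B6]'s solved-problem language

LANDING NOTE (porter ▶ PTC-1 g4, 2026-08-31; AUTHORSHIP = ◇ lens-1 g10 «cauchy-analytic», HOME sketch `nodeO-cover/LENS-1g10-Rb-5-OrbitIffCritModGauge-v2.lean` sha16 264a221222d2fceb · 261 l. · 3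
def (receipt PREDICATES (C-wcg) `RootedResponseCriticalModGaugeAt`, (C-crit) `RootedResponseInvCriticalAt`, (C-cons) `RootedResponseConstraintModGaugeAt`, in ◆'s namespace `K0AxCtabUniq` next to
the STRUCK ✓`RootedResponseWeaklyCriticalAt`) + 9 thm · 0 sorry; v1 4cf0ec95 superseded before any cut): landed VERBATIM (only this paragraph added) under the basename ◇ lens-1 proposed
(`…K0AxCtabOrbitIffCrit`), as INTENT-46 (PART B-5; tree imports only — independent of B-1…B-4), on ★★★ director-ym №550 (d3) and ◆ CRIT-1 g37's cut: (d3) CUT PASS∕GO — J4 PASS, J5′ PASS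
(equation-class letters, (C-wcg) proved equivalent to the LEGAL (C-orb)), SAME-WALL bookkeeping, axioms standard on ◆'s own run, dedup 12∕12 fresh; advisory: the three receipts stay orphans until
P0∕PT-A targets (C-crit) ∧ (C-cons) (nodeO STATUS 2026-08-31T10:24:18Z); helper `--supports
stmt-QuantumFields-27238 --as helper` (NO `--workitem`; gate kind = definition by the `def` rule, «async audit instead of review» as for ✓`…K0AxJoinTD9`).  HONEST (porter): linear algebra over the
tree's [B6] model ∕ hypothesis deletions; CONDITIONAL theorems; every displayed letter ((C-orb)∕(C-wcg)∕(C-crit)∕(C-cons), TokP9reg♭, D1 = ⟨27930⟩'s ⁸ consequent) OPEN, asserted nowhere; [E]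
inhabited unconditionally NOWHERE; nothing of Bałaban asserted, ported, discharged or refuted; K0ᴬ stmt-QuantumFields-27238 OPEN — NOTHING of it proved; NODE O 0∕1; COUNT 8∕28 · K 1∕4 UNMOVED;
finite 𝕋⁴ at fixed ε — NOT continuum ∕ OS ∕ Clay; the Yang–Mills mass gap is NOT proved by any of this.

Unit `ymgap-nodeO-lens-1` g10 (lens-1 = typist of the (R-a) row, director №541∕№543).  NAMESPACE `Summit.QuantumFields.YangMills.Theorems.K0AxCtabUniq` (the home of
✓`WeaklyCritical`, ✓`weaklyCritical_univ_iff`, the STRUCK receipt (C-tab-opt) `RootedResponseWeaklyCriticalAt` and my tube theorem ✓`K0AxCtabOptTube`).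

WHAT.  One displayed letter of the road of record after (B-4) is (C-orb) ✓`K0RecordFormatNames.RootedResponseOrbitAt F θ k K a l`: «entrywise, `recordD a l − recordHrLocξ univ a l`
is the lattice gradient of an UNRESTRICTED site potential».  This file re-expresses it in the language in which the tree has already SOLVED the linearised constrained
variational problem ([B6] Sect. A: ✓`weaklyCritical_iff` ∕ ✓`weaklyCritical_univ_iff` — weakly critical ⟺ `H₁e_l` up to a RESTRICTED gauge `∂λ, λ ∈ N(Q′)`):

* RECEIPT (C-wcg) `RootedResponseCriticalModGaugeAt F θ k K a l` (§1): «for SOME unrestricted site potential `φ₀`, every matrix entry of the chart-unit re-gauged rooted response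
  `ξ⁻¹·(recordD a l − ∂φ₀)` is WEAKLY CRITICAL (constraint `Q x = datum` + vanishing first variation of (2.5) along `ker Q`, NO gauge condition) for the global problem with datum the
  matching part of `ρ₈(bV a)_{ii′}·e_l`».  Print: the (0.21) minimiser in ANY gauge is critical on the constraint surface ((178) p.306); the ROOTED (axial) copy satisfies the
  block-average constraint only up to conjugation by the rooting gauge at the coarse sites, whose `B`-derivative at `0` is the unrestricted `φ₀` — so (C-wcg) is the honest
  linearisation of «the rooted minimiser is a gauge copy of a constrained critical point», with the STRUCK (C-tab-opt) being its `φ₀ = 0` instance (which forces the restricted class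
  and hence Tok-182, ✓`K0AxCtabOptTube`).
* ★★ `rootedResponseOrbitAt_of_criticalModGauge` (§2): on the range `k + 1 ≤ m + K`, (C-wcg) ⟹ (C-orb) — by ✓`weaklyCritical_univ_iff` each entry of `ξ⁻¹(recordD − ∂φ₀)` is
  `ρ·windowResp univ l + ∂n` with `n` restricted, so `recordD − recordHrLocξ univ = ∂(φ₀ + ξ(n + i m))`.
* ★ `criticalModGauge_of_rootedResponseOrbitAt` (§3): (C-orb) ⟹ (C-wcg) unconditionally — take `φ₀ := φ`; then `ξ⁻¹(recordD − ∂φ) = windowResp univ l · ρ₈(bV a)` entrywise, which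
  is weakly critical with `n = 0` (✓`weaklyCritical_univ_iff`, i.e. ✓`weaklyCritical_hOp`).
* §4 (v2) THE SPLIT OF (C-wcg) INTO ITS GAUGE-FREE AND ITS GAUGE-CARRYING HALVES: the criticality clause of `WeaklyCritical` is DATUM-FREE and invariant under UNRESTRICTED gradients
  (`∂̃∂ = 0`, ✓`B6SectCTwoScaleV1Lattice.dcE_dE` — no `N(Q′)` needed), so (C-wcg) ⟺ (C-crit) ∧ (C-cons) with (C-crit) `RootedResponseInvCriticalAt` := «the chart-unit rooted response
  itself is (2.5)-critical along `ker Q`» (NO `φ₀`, NO datum: the linearised Euler–Lagrange equation `∂̃*∂̃ D ∈ range Q*`, shared by every gauge copy — what P0 reads off the minimiser)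
  and (C-cons) `RootedResponseConstraintModGaugeAt` := «`Q(ξ⁻¹(recordD − ∂φ₀)) = datum` for SOME unrestricted `φ₀`» (the linearised block-average constraint up to the rooting gauge —
  where ALL of `φ₀` lives): ★★ `criticalModGauge_iff_invCritical_and_constraintModGauge`, hence ★★ `rootedResponseOrbitAt_iff_invCritical_and_constraintModGauge` on the range.
* ★★ `rootedResponseOrbitAt_iff_criticalModGauge` (§3): the EQUIVALENCE on the range; so (C-orb) carries exactly the content «rooted response = a gauge copy of a weakly critical
  configuration» and NOTHING about which gauge — the supplier P0∕PT-A must deliver is (C-wcg): the `B`-derivative at `0` of [constraint + invariant first-order optimality] of some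
  gauge copy of the rooted minimiser (HypAn = P0 makes it a derivative at all).

HONEST.  Finite-dimensional linear algebra over the tree's [B6] Sect. A model + bookkeeping of real∕imaginary parts; CONDITIONAL in nothing and ASSERTING nothing of Bałaban: both
letters stay DISPLAYED∕OPEN (neither is inhabited here); (C-tab-opt) stays STRUCK (№543); P0 (HypAn), (D1) ⟨27930⟩, TokP9reg♭, (Tok-cmpU-cap) OPEN; K0ᴬ 27238 ∕ K0⁷ 20541 OPEN;
NODE O 0∕1; COUNT 8∕28 · K 1∕4 unmoved; finite 𝕋⁴_{L^K} at fixed ε — NOT continuum ∕ OS ∕ Clay; the Yang–Mills mass gap is NOT proved.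
-/

open scoped InnerProductSpace

namespace Summit.QuantumFields.YangMills.Theorems.K0AxCtabUniq

open Literature.MathematicalPhysics.QuantumFieldTheory.Balaban1983to89
open LatticeFieldCalculus B6SectADomainsV1 B6SectAOperatorsV1 B6SectAVectorModelV1 B6SectACriticalPointV1
open Literature.MathematicalPhysics.QuantumFieldTheory.BalabanImbrieJaffe1984to88.BIJ85AxialPropagator411 (BondSpace PlaqSpace)
open Summit.QuantumFields.YangMills.Theorems.K0RecordFormatNames
open Literature.MathematicalPhysics.QuantumFieldTheory.Balaban1983to89.T4Continuum (T4Family)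
open Literature.MathematicalPhysics.QuantumFieldTheory.Balaban1983to89.Node00

noncomputable section

variable (F : T4Family) (θ : Stage13Params F 2)

/-! ## §1  RECEIPT (C-wcg): weakly critical modulo an unrestricted gauge -/

/-- **RECEIPT (C-wcg) `RootedResponseCriticalModGaugeAt F θ k K a l`** — for some UNRESTRICTED site potential `φ₀ : sites → ℂ^{2×2}`, every matrix entry `(i, i′)` of the
chart-unit re-gauged rooted response `ξ⁻¹·(recordD a l − ∂φ₀)` (real and imaginary parts separately) is `WeaklyCritical` for the global linearised problem on `univDomains` with
datum the matching part of `ρ₈(bV a)_{ii′}·e_l`.  The `φ₀ = 0` instance is the STRUCK receipt (C-tab-opt) ✓`RootedResponseWeaklyCriticalAt` (№543; it forces Tok-182,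
✓`K0AxCtabOptTube`); (C-wcg) is its honest gauge-free form and is EQUIVALENT to (C-orb) on `k + 1 ≤ m + K` (§3).  DISPLAYED — asserts nothing; needs P0's HypAn to be about a
derivative at all. [cite: Balaban1985Variational, (176)–(178) p.306, Prop. 9 p.309; Balaban1984PropagatorsII, (2.5)–(2.8) p.224, (2.12) p.225, (2.35) p.228; Balaban1987RG1, (4.35) p.290] -/
def RootedResponseCriticalModGaugeAt (k K : ℕ) (a : θ.ιβ) (l : RespLabel F k K) : Prop :=
  letI := θ.instVβ₁; letI := θ.instVβ₂
  ∃ φ₀ : Site (F.P K) 0 → Fin 2 → Fin 2 → ℂ, ∀ hk : k + 1 ≤ (F.P K).m + (F.P K).K, ∀ i i' : Fin 2,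
    WeaklyCritical (univDomains F k K hk) 1 ((θ.ρ8 (θ.bV a) i i').re • windowSrc F k K hk Finset.univ l)
        (reBond F K fun b => (((F.P K).eta (k + 1))⁻¹ : ℂ) * (recordD F θ k K a l b i i' - (φ₀ b.tgt i i' - φ₀ b.src i i'))) ∧
      WeaklyCritical (univDomains F k K hk) 1 ((θ.ρ8 (θ.bV a) i i').im • windowSrc F k K hk Finset.univ l)
        (imBond F K fun b => (((F.P K).eta (k + 1))⁻¹ : ℂ) * (recordD F θ k K a l b i i' - (φ₀ b.tgt i i' - φ₀ b.src i i')))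

/-! ## §2  (C-wcg) ⟹ (C-orb): a weakly critical entry is `H₁e_l` up to a restricted gauge (✓`weaklyCritical_univ_iff`), so the rooted response is `recordHrLocξ univ` up to an unrestricted one -/

/-- GENERIC ENTRY LEMMA (the proof of ✓`recordD_sub_recordHrLocξ_univ_of_weaklyCritical` with the rooted entry replaced by an arbitrary complex bond function `x`): if the real and
imaginary parts of `ξ⁻¹·x` are weakly critical with data the parts of `ρ₈(bV a)_{ii′}·e_l`, then `x − recordHrLocξ univ a l · i i′ = ξ·∂(n + i m)` with `n, m ∈ N(Q′)`.
[cite: Balaban1984PropagatorsII, (2.12) p.225, (2.35) p.228; Balaban1985Variational, (176) p.306, (21) p.281; Balaban1987RG1, (4.35) p.290] -/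
theorem sub_recordHrLocξ_univ_of_weaklyCritical_entry (k K : ℕ) (hk : k + 1 ≤ (F.P K).m + (F.P K).K) (a : θ.ιβ) (l : RespLabel F k K)
    (i i' : Fin 2) (x : PBond (F.P K) 0 → ℂ)
    (hre : letI := θ.instVβ₁; letI := θ.instVβ₂
      WeaklyCritical (univDomains F k K hk) 1 ((θ.ρ8 (θ.bV a) i i').re • windowSrc F k K hk Finset.univ l)
        (reBond F K fun b => (((F.P K).eta (k + 1))⁻¹ : ℂ) * x b))
    (him : letI := θ.instVβ₁; letI := θ.instVβ₂
      WeaklyCritical (univDomains F k K hk) 1 ((θ.ρ8 (θ.bV a) i i').im • windowSrc F k K hk Finset.univ l)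
        (imBond F K fun b => (((F.P K).eta (k + 1))⁻¹ : ℂ) * x b)) :
    ∃ n m : ScalarSpace (F.P K), n ∈ LinearMap.ker (QpE (univDomains F k K hk)) ∧
      m ∈ LinearMap.ker (QpE (univDomains F k K hk)) ∧
      ∀ b, x b - recordHrLocξ F θ k K Finset.univ a l b i i' =
        ((F.P K).eta (k + 1) : ℂ) * ((WithLp.ofLp (dE 1 n) b : ℂ) + (WithLp.ofLp (dE 1 m) b : ℂ) * Complex.I) := by
  letI := θ.instVβ₁; letI := θ.instVβ₂
  obtain ⟨n, hn, hre'⟩ := (weaklyCritical_univ_iff F k K hk l _ _).mp hre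
  obtain ⟨m, hm, him'⟩ := (weaklyCritical_univ_iff F k K hk l _ _).mp him
  refine ⟨n, m, hn, hm, fun b => ?_⟩
  set ξ : ℝ := (F.P K).eta (k + 1) with hξ
  have hξ0 : (ξ : ℂ) ≠ 0 := by
    exact_mod_cast (pow_pos (inv_pos.mpr (Nat.cast_pos.mpr (F.P K).L_pos)) (k + 1) : 0 < (F.P K).eta (k + 1)).ne'
  set z : ℂ := ((ξ : ℂ)⁻¹) * x b with hz
  have h1 := hre' b
  have h2 := him' b
  simp only [WithLp.ofLp_sub, Pi.sub_apply, reBond, imBond] at h1 h2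
  have hzre : z.re = (θ.ρ8 (θ.bV a) i i').re * windowResp F k K Finset.univ l b + WithLp.ofLp (dE 1 n) b := by
    rw [hz]; linarith
  have hzim : z.im = (θ.ρ8 (θ.bV a) i i').im * windowResp F k K Finset.univ l b + WithLp.ofLp (dE 1 m) b := by
    rw [hz]; linarith
  have hD : x b = (ξ : ℂ) * z := by
    rw [hz, ← mul_assoc, mul_inv_cancel₀ hξ0, one_mul]
  have hH : recordHrLocξ F θ k K Finset.univ a l b i i' = ((ξ * windowResp F k K Finset.univ l b : ℝ) : ℂ) * θ.ρ8 (θ.bV a) i i' := by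
    simp only [recordHrLocξ, windowRespξ, hξ]
  rw [hD, hH]
  apply Complex.ext
  · simp only [Complex.sub_re, Complex.mul_re, Complex.ofReal_re, Complex.ofReal_im, Complex.add_re, Complex.add_im,
      Complex.mul_im, Complex.I_re, Complex.I_im, hzre, hzim]
    ring
  · simp only [Complex.sub_im, Complex.mul_re, Complex.ofReal_re, Complex.ofReal_im, Complex.add_re, Complex.add_im,
      Complex.mul_im, Complex.I_re, Complex.I_im, hzre, hzim]
    ring

/-- ★★ **(C-wcg) ⟹ (C-orb)** on the range `k + 1 ≤ m + K` (automatic at the record's volumes `K = recordK₀ F Mc k + n`): the rooted response is DEF-1's chart-unit localized response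
at the window `univ` up to the gradient of the UNRESTRICTED potential `φ := φ₀ + ξ·(n + i m)` (§2's restricted `n, m` per entry, absorbed into `φ₀`).
[cite: Balaban1985Variational, (176)–(178) p.306, (21) p.281; Balaban1984PropagatorsII, (2.12) p.225, (2.35) p.228; Balaban1987RG1, (4.35) p.290] -/
theorem rootedResponseOrbitAt_of_criticalModGauge (k K : ℕ) (hk : k + 1 ≤ (F.P K).m + (F.P K).K) (a : θ.ιβ) (l : RespLabel F k K)
    (h : RootedResponseCriticalModGaugeAt F θ k K a l) : RootedResponseOrbitAt F θ k K a l := by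
  letI := θ.instVβ₁; letI := θ.instVβ₂
  obtain ⟨φ₀, hφ₀⟩ := h
  have key : ∀ i i' : Fin 2, ∃ n m : ScalarSpace (F.P K), ∀ b : PBond (F.P K) 0,
      recordD F θ k K a l b i i' - (φ₀ b.tgt i i' - φ₀ b.src i i') - recordHrLocξ F θ k K Finset.univ a l b i i' =
        ((F.P K).eta (k + 1) : ℂ) * ((WithLp.ofLp (dE 1 n) b : ℂ) + (WithLp.ofLp (dE 1 m) b : ℂ) * Complex.I) := fun i i' => by
    obtain ⟨n, m, -, -, hnm⟩ := sub_recordHrLocξ_univ_of_weaklyCritical_entry F θ k K hk a l i i'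
      (fun b => recordD F θ k K a l b i i' - (φ₀ b.tgt i i' - φ₀ b.src i i')) (hφ₀ hk i i').1 (hφ₀ hk i i').2
    exact ⟨n, m, hnm⟩
  choose n m hnm using key
  refine ⟨fun y i i' => φ₀ y i i' +
      ((F.P K).eta (k + 1) : ℂ) * (((WithLp.ofLp (n i i') y : ℝ) : ℂ) + ((WithLp.ofLp (m i i') y : ℝ) : ℂ) * Complex.I),
    fun b i i' => ?_⟩
  have h := hnm i i' b
  simp only [ofLp_dE, LatticeFieldCalculus.grad, one_smul, Complex.ofReal_sub] at h
  linear_combination h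

/-! ## §3  (C-orb) ⟹ (C-wcg) (take `φ₀ := φ`: `H₁e_l` itself is weakly critical), and the equivalence -/

/-- ★ **(C-orb) ⟹ (C-wcg)**, unconditionally: with `φ₀ := φ` the re-gauged rooted response IS `recordHrLocξ univ = ξ·windowResp univ l·ρ₈(bV a)` entrywise, and each part of
`windowResp univ l · ρ₈(bV a)_{ii′}` is weakly critical with the restricted potential `0` (✓`weaklyCritical_univ_iff`, ⟸ ✓`weaklyCritical_hOp`).
[cite: Balaban1984PropagatorsII, (2.12) p.225, (2.35) p.228; Balaban1985Variational, (176)–(178) p.306; Balaban1987RG1, (4.35) p.290] -/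
theorem criticalModGauge_of_rootedResponseOrbitAt (k K : ℕ) (a : θ.ιβ) (l : RespLabel F k K)
    (h : RootedResponseOrbitAt F θ k K a l) : RootedResponseCriticalModGaugeAt F θ k K a l := by
  letI := θ.instVβ₁; letI := θ.instVβ₂
  obtain ⟨φ, hφ⟩ := h
  refine ⟨φ, fun hk i i' => ?_⟩
  set ξ : ℝ := (F.P K).eta (k + 1) with hξ
  have hξ0 : (ξ : ℂ) ≠ 0 := by
    exact_mod_cast (pow_pos (inv_pos.mpr (Nat.cast_pos.mpr (F.P K).L_pos)) (k + 1) : 0 < (F.P K).eta (k + 1)).ne'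
  have hx : (fun b : PBond (F.P K) 0 => ((ξ : ℂ)⁻¹) * (recordD F θ k K a l b i i' - (φ b.tgt i i' - φ b.src i i'))) =
      fun b => ((windowResp F k K Finset.univ l b : ℝ) : ℂ) * θ.ρ8 (θ.bV a) i i' := by
    funext b
    have hb : recordD F θ k K a l b i i' - (φ b.tgt i i' - φ b.src i i') = recordHrLocξ F θ k K Finset.univ a l b i i' := by
      rw [← hφ b i i']; ring
    have hH : recordHrLocξ F θ k K Finset.univ a l b i i' = ((ξ * windowResp F k K Finset.univ l b : ℝ) : ℂ) * θ.ρ8 (θ.bV a) i i' := by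
      simp only [recordHrLocξ, windowRespξ, hξ]
    rw [hb, hH, Complex.ofReal_mul, ← mul_assoc, ← mul_assoc, inv_mul_cancel₀ hξ0, one_mul]
  rw [hx]
  refine ⟨(weaklyCritical_univ_iff F k K hk l _ _).mpr ⟨0, Submodule.zero_mem _, fun b => ?_⟩,
    (weaklyCritical_univ_iff F k K hk l _ _).mpr ⟨0, Submodule.zero_mem _, fun b => ?_⟩⟩
  · simp only [map_zero, sub_zero, reBond, WithLp.ofLp_toLp, Complex.re_ofReal_mul]
    ring
  · simp only [map_zero, sub_zero, imBond, WithLp.ofLp_toLp, Complex.im_ofReal_mul]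
    ring

/-- ★★ **(C-orb) ⟺ (C-wcg)** on `k + 1 ≤ m + K`: the displayed orbit letter of the road of record says EXACTLY «the rooted response is a gauge copy of a weakly critical configuration»
([B6] (2.5)–(2.8) criticality on the constraint surface, solved in the tree by (2.35) up to N(Q′)), and nothing about WHICH gauge.
[cite: Balaban1985Variational, (176)–(178) p.306, Prop. 9 p.309; Balaban1984PropagatorsII, (2.12) p.225, (2.35) p.228; Balaban1987RG1, (4.35) p.290] -/
theorem rootedResponseOrbitAt_iff_criticalModGauge (k K : ℕ) (hk : k + 1 ≤ (F.P K).m + (F.P K).K) (a : θ.ιβ) (l : RespLabel F k K) :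
    RootedResponseOrbitAt F θ k K a l ↔ RootedResponseCriticalModGaugeAt F θ k K a l :=
  ⟨criticalModGauge_of_rootedResponseOrbitAt F θ k K a l, rootedResponseOrbitAt_of_criticalModGauge F θ k K hk a l⟩


/-! ## §4 (v2)  THE SPLIT: (C-wcg) ⟺ (C-crit) ∧ (C-cons) — the criticality clause is datum-free and blind to UNRESTRICTED gauges (`∂̃∂ = 0`) -/

/-- **RECEIPT (C-crit) `RootedResponseInvCriticalAt F θ k K a l`** — the chart-unit rooted response ITSELF (no re-gauging, no datum) is (2.5)-critical along `ker Q`: for every entry and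
every `v` with `Q v = 0`, `⟪∂̃(ξ⁻¹·recordD a l · i i′), ∂̃v⟫ = 0` (real and imaginary parts) — the linearised Euler–Lagrange equation `∂̃*∂̃D ∈ (ker Q)^⊥ = range Q*`, shared by EVERY gauge
copy of the response since `∂̃∂ = 0`.  DISPLAYED — asserts nothing (P0∕HypAn reads it off the first-order optimality of the (0.21) minimiser, (178) p.306).
[cite: Balaban1985Variational, (178) p.306, Prop. 9 p.309; Balaban1984PropagatorsII, (2.5)–(2.8) p.224] -/
def RootedResponseInvCriticalAt (k K : ℕ) (a : θ.ιβ) (l : RespLabel F k K) : Prop :=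
  ∀ hk : k + 1 ≤ (F.P K).m + (F.P K).K, ∀ i i' : Fin 2, ∀ v : BondSpace (F.P K), QE (univDomains F k K hk) v = 0 →
    ⟪dcE 1 (reBond F K fun b => (((F.P K).eta (k + 1))⁻¹ : ℂ) * recordD F θ k K a l b i i'), dcE 1 v⟫_ℝ = 0 ∧
      ⟪dcE 1 (imBond F K fun b => (((F.P K).eta (k + 1))⁻¹ : ℂ) * recordD F θ k K a l b i i'), dcE 1 v⟫_ℝ = 0

/-- **RECEIPT (C-cons) `RootedResponseConstraintModGaugeAt F θ k K a l`** — for SOME unrestricted site potential `φ₀`, the re-gauged chart-unit rooted response satisfies the LINEARISED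
BLOCK-AVERAGE CONSTRAINT exactly: `Q(ξ⁻¹(recordD a l − ∂φ₀) · i i′) = ρ₈(bV a)_{ii′} · e_l` (parts).  This is where the rooting gauge lives (the rooted minimiser satisfies `Q_k U = V` only up
to conjugation at the coarse sites; `φ₀` = its derivative).  DISPLAYED — asserts nothing. [cite: Balaban1985Variational, (176)–(178) p.306; Balaban1984PropagatorsII, (2.6) p.224; Balaban1987RG1, (4.35) p.290] -/
def RootedResponseConstraintModGaugeAt (k K : ℕ) (a : θ.ιβ) (l : RespLabel F k K) : Prop :=
  letI := θ.instVβ₁; letI := θ.instVβ₂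
  ∃ φ₀ : Site (F.P K) 0 → Fin 2 → Fin 2 → ℂ, ∀ hk : k + 1 ≤ (F.P K).m + (F.P K).K, ∀ i i' : Fin 2,
    QE (univDomains F k K hk)
        (reBond F K fun b => (((F.P K).eta (k + 1))⁻¹ : ℂ) * (recordD F θ k K a l b i i' - (φ₀ b.tgt i i' - φ₀ b.src i i'))) =
      (θ.ρ8 (θ.bV a) i i').re • windowSrc F k K hk Finset.univ l ∧
    QE (univDomains F k K hk)
        (imBond F K fun b => (((F.P K).eta (k + 1))⁻¹ : ℂ) * (recordD F θ k K a l b i i' - (φ₀ b.tgt i i' - φ₀ b.src i i'))) =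
      (θ.ρ8 (θ.bV a) i i').im • windowSrc F k K hk Finset.univ l

/-- Bookkeeping: re-gauging a complex bond function by an unrestricted site potential shifts its (scaled) real part by a lattice GRADIENT.
[cite: Balaban1984PropagatorsII, (2.7) p.224 (bookkeeping)] -/
theorem reBond_mul_sub_grad (K : ℕ) (r : ℝ) (x : PBond (F.P K) 0 → ℂ) (φ : Site (F.P K) 0 → ℂ) :
    reBond F K (fun b => (r : ℂ) * (x b - (φ b.tgt - φ b.src))) =
      reBond F K (fun b => (r : ℂ) * x b) - dE 1 (WithLp.toLp 2 fun y => ((r : ℂ) * φ y).re) := by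
  refine WithLp.ofLp_injective 2 (funext fun b => ?_)
  simp only [reBond, WithLp.ofLp_toLp, WithLp.ofLp_sub, Pi.sub_apply, ofLp_dE, LatticeFieldCalculus.grad, one_smul, mul_sub,
    Complex.sub_re]

/-- Bookkeeping: the same for the imaginary part. [cite: Balaban1984PropagatorsII, (2.7) p.224 (bookkeeping)] -/
theorem imBond_mul_sub_grad (K : ℕ) (r : ℝ) (x : PBond (F.P K) 0 → ℂ) (φ : Site (F.P K) 0 → ℂ) :
    imBond F K (fun b => (r : ℂ) * (x b - (φ b.tgt - φ b.src))) =
      imBond F K (fun b => (r : ℂ) * x b) - dE 1 (WithLp.toLp 2 fun y => ((r : ℂ) * φ y).im) := by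
  refine WithLp.ofLp_injective 2 (funext fun b => ?_)
  simp only [imBond, WithLp.ofLp_toLp, WithLp.ofLp_sub, Pi.sub_apply, ofLp_dE, LatticeFieldCalculus.grad, one_smul, mul_sub,
    Complex.sub_im]

/-- ★ **The criticality clause is blind to unrestricted gauges**: `∂̃(re∕im of ξ⁻¹(x − ∂φ)) = ∂̃(re∕im of ξ⁻¹x)` (✓`dcE_dE`: `∂̃∂ = 0` for EVERY potential, restricted or not).
[cite: Balaban1984PropagatorsII, (2.7)–(2.8) p.224] -/
theorem dcE_reBond_mul_sub_grad (K : ℕ) (r : ℝ) (x : PBond (F.P K) 0 → ℂ) (φ : Site (F.P K) 0 → ℂ) :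
    dcE 1 (reBond F K (fun b => (r : ℂ) * (x b - (φ b.tgt - φ b.src)))) = dcE 1 (reBond F K fun b => (r : ℂ) * x b) ∧
      dcE 1 (imBond F K (fun b => (r : ℂ) * (x b - (φ b.tgt - φ b.src)))) = dcE 1 (imBond F K fun b => (r : ℂ) * x b) := by
  rw [reBond_mul_sub_grad, imBond_mul_sub_grad, map_sub, map_sub, B6SectCTwoScaleV1Lattice.dcE_dE, B6SectCTwoScaleV1Lattice.dcE_dE,
    sub_zero, sub_zero]
  exact ⟨rfl, rfl⟩

/-- ★★ **(C-wcg) ⟺ (C-crit) ∧ (C-cons)**: weak criticality of the re-gauged rooted response = [criticality of the rooted response ITSELF along `ker Q` (datum-free, `φ₀`-free)] ∧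
[the linearised constraint modulo an unrestricted gauge].  So the supplier's two jobs are SEPARATE: (C-crit) is the derivative of the Euler–Lagrange equation in ANY gauge; (C-cons) is the
derivative of the block-average constraint in the ROOTED gauge, up to the rooting gauge. [cite: Balaban1985Variational, (176)–(178) p.306; Balaban1984PropagatorsII, (2.5)–(2.8) p.224, (2.12) p.225] -/
theorem criticalModGauge_iff_invCritical_and_constraintModGauge (k K : ℕ) (a : θ.ιβ) (l : RespLabel F k K) :
    RootedResponseCriticalModGaugeAt F θ k K a l ↔
      RootedResponseInvCriticalAt F θ k K a l ∧ RootedResponseConstraintModGaugeAt F θ k K a l := by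
  letI := θ.instVβ₁; letI := θ.instVβ₂
  have hξ : (((F.P K).eta (k + 1))⁻¹ : ℂ) = (((F.P K).eta (k + 1))⁻¹ : ℝ) := by push_cast; rfl
  constructor
  · rintro ⟨φ₀, h⟩
    refine ⟨fun hk i i' v hv => ?_, φ₀, fun hk i i' => ⟨(h hk i i').1.1, (h hk i i').2.1⟩⟩
    have hc := dcE_reBond_mul_sub_grad F K ((F.P K).eta (k + 1))⁻¹ (fun b => recordD F θ k K a l b i i') (fun y => φ₀ y i i')
    rw [← hξ] at hc
    have h1 := (h hk i i').1.2 v hv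
    have h2 := (h hk i i').2.2 v hv
    rw [hc.1] at h1
    rw [hc.2] at h2
    exact ⟨h1, h2⟩
  · rintro ⟨hcrit, φ₀, hcons⟩
    refine ⟨φ₀, fun hk i i' => ⟨⟨(hcons hk i i').1, fun v hv => ?_⟩, ⟨(hcons hk i i').2, fun v hv => ?_⟩⟩⟩
    · have hc := dcE_reBond_mul_sub_grad F K ((F.P K).eta (k + 1))⁻¹ (fun b => recordD F θ k K a l b i i') (fun y => φ₀ y i i')
      rw [← hξ] at hc
      rw [hc.1]
      exact (hcrit hk i i' v hv).1
    · have hc := dcE_reBond_mul_sub_grad F K ((F.P K).eta (k + 1))⁻¹ (fun b => recordD F θ k K a l b i i') (fun y => φ₀ y i i')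
      rw [← hξ] at hc
      rw [hc.2]
      exact (hcrit hk i i' v hv).2

/-- ★★ **(C-orb) ⟺ (C-crit) ∧ (C-cons)** on `k + 1 ≤ m + K`: the displayed orbit letter = [rooted response critical along `ker Q`] ∧ [linearised constraint up to an unrestricted gauge].
[cite: Balaban1985Variational, (176)–(178) p.306, Prop. 9 p.309; Balaban1984PropagatorsII, (2.5)–(2.8) p.224, (2.12) p.225, (2.35) p.228; Balaban1987RG1, (4.35) p.290] -/
theorem rootedResponseOrbitAt_iff_invCritical_and_constraintModGauge (k K : ℕ) (hk : k + 1 ≤ (F.P K).m + (F.P K).K) (a : θ.ιβ)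
    (l : RespLabel F k K) :
    RootedResponseOrbitAt F θ k K a l ↔
      RootedResponseInvCriticalAt F θ k K a l ∧ RootedResponseConstraintModGaugeAt F θ k K a l :=
  (rootedResponseOrbitAt_iff_criticalModGauge F θ k K hk a l).trans
    (criticalModGauge_iff_invCritical_and_constraintModGauge F θ k K a l)

end

end Summit.QuantumFields.YangMills.Theorems.K0AxCtabUniq
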